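import Mathlib
import Literature.Computability.Complexity.Classes
import Literature.Computability.Complexity.BoolEncodings
import Literature.Computability.Complexity.GraphEncodings
import Literature.Computability.Complexity.CodeFPArith
import HarnessLib

/-!
# Integer linear programming with a fixed number of variables: the problem (H. W. Lenstra 1983)

Topic `Computability/Complexity`. The decision problem INTEGER LINEAR PROGRAMMING (feasibility
form) as printed by H. W. Lenstra, Jr., *Integer programming with a fixed number of variables*,
Math. Oper. Res. 8 (1983) 538–548, §1 (p. 538): "Let `n` and `m` be positive integers, `A` an
`m × n`-matrix with integral coefficients, and `b ∈ ℤ^m`. The question is to decide whether there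
exists a vector `x ∈ ℤⁿ` satisfying the system of `m` inequalities `Ax ≤ b`." This file fixes the
VOCABULARY only (instances, feasibility, the Boolean encoding, the language and its fixed-dimension
slices), over the tree's machinery (`BoolEncodings.lean`, `GraphEncodings.lean`, `Classes.lean`):

* `ILPInstance = Σ n, List ((Fin n → ℤ) × ℤ)` — the number of variables `n` and the system
  `Ax ≤ b` given as the list of its `m` rows `(aᵢ, bᵢ) ∈ ℤⁿ × ℤ` (row `i` reads `aᵢ · x ≤ bᵢ`; the same
  shape as the tree's affine systems `FKPointLocation.Eqn`), `ILPInstance.Feasible`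
  (`∃ x ∈ ℤⁿ, ∀ i, aᵢ · x ≤ bᵢ`), its Boolean `encoding` (binary dimension header, then Mathlib-style
  `listBool` of the rows, each row the pair of the `listBool` code of `aᵢ` and the sign–magnitude code
  of `bᵢ`: `Encoding.sigmaBool fun n => ((encodingFinVec encodingIntBool n).pairBool encodingIntBool).listBool`,
  the format of `Literature.Algebra.EuclideanLattices.intVecEncoding`), the language `ilpLang` and its
  fixed-dimension slices `ilpLangOfDim n` — the languages Lenstra's theorem ("for any fixed value of
  `n` there exists a polynomial algorithm for the solution of the integer linear programming problem",
  loc. cit.; Schrijver 1986, Cor. 18.7a) places in `P`.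

First user: the discharge of `Literature.NumberTheory.DiophantineApproximation.Lagarias1985_gsaOfDim_mem_P`
(Lagarias 1985: GOOD SIMULTANEOUS APPROXIMATION in fixed dimension `d` is in `P`), whose printed proof
is the observation that GSA in dimension `d` is an integer program in the `d + 1` variables
`(q, p₁, …, p_d)` with a bounded polyhedron, followed by Lenstra's algorithm; the algorithm itself
(for bounded polyhedra, in fixed dimension) is formalized in the sibling files
`IntegerProgrammingFixedDimension*.lean` on top of this vocabulary.

## Design notes

* Rows instead of a `Matrix (Fin m) (Fin n) ℤ` and a vector: an instance of every shape `m × n` must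
  live in ONE type to be a language; the list of rows is that type with the least junk (no `m`
  header to keep consistent), and `Feasible` quantifies over the rows (`∀ r ∈ rows`), so order and
  repetitions are immaterial. `feasible_iff_mulVec` restates it as `∃ x, A *ᵥ x ≤ b` for the matrix
  of a `Fin m`-indexed family of rows.
* `n = 0` and `m = 0` are allowed (Lenstra takes `n, m` positive): with no rows every instance is
  feasible (`feasible_nil`), with `n = 0` feasibility is `∀ i, 0 ≤ bᵢ`.
* The code of `⟨n, rows⟩` in the vocabulary of `CodeFP.lean` is
  `pairE natE (listE (pairE (listE smE) smE)) (n, rows.map fun r => (List.ofFn r.1, r.2))`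
  (`encode_eq_pairE`), so that instance maps INTO this problem, and deciders FOR it, are assembled
  from the typed combinators of `CodeFP*.lean` on the list form `List (List ℤ × ℤ)` of the rows.

## References

* H. W. Lenstra, Jr., *Integer programming with a fixed number of variables*, Math. Oper. Res. 8
  (1983) 538–548, §1 (problem statement and main theorem). [LenstraHW1983]
* A. Schrijver, *Theory of Linear and Integer Programming*, Wiley 1986, §18.1 (ILP), §18.4,
  Cor. 18.7a (Lenstra's algorithm). [Schrijver1986]
* S. Arora, B. Barak, *Computational Complexity: A Modern Approach*, CUP 2009, §0.1 (codes),
  Def. 1.13 (`P`). [AroraBarak2009]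

## NOT here (deliberately)

* Lenstra's THEOREM as a named fact and his ALGORITHM (rounding the polyhedron, LLL, recursion on
  a bounded number of hyperplane sections): the algorithm for bounded polyhedra is proved in the
  sibling files; the general statement (unbounded polyhedra need the small-solution bound of
  von zur Gathen–Sieveking / Schrijver 1986 Cor. 17.1) is not vendored as an unproved fact (D-0026).
* NP-completeness of ILP with `n` varying (Schrijver 1986 §18.1) and the optimisation /
  mixed-integer corollaries (Schrijver 1986, Cor. 18.7b–c): not needed by any user yet.
-/

namespace Literature.Computability.Complexity

open _root_.Computability

/-! ### Instances, feasibility -/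

/-- Instances of INTEGER LINEAR PROGRAMMING (feasibility form): `⟨n, rows⟩` with `n` the number of
variables and `rows` the system `Ax ≤ b` listed row by row, row `(a, β) ∈ ℤⁿ × ℤ` reading
`a · x ≤ β`. [cite: LenstraHW1983, §1 (p. 538, problem statement)] -/
abbrev ILPInstance : Type := Σ n : ℕ, List ((Fin n → ℤ) × ℤ)

namespace ILPInstance

/-- The number of variables `n` of an ILP instance. [folklore] -/
abbrev numVars (P : ILPInstance) : ℕ := P.1

/-- The rows `(aᵢ, bᵢ)` of an ILP instance (the system `Ax ≤ b`). [folklore] -/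
abbrev rows (P : ILPInstance) : List ((Fin P.numVars → ℤ) × ℤ) := P.2

/-- A row `(a, β)` is satisfied by `x ∈ ℤⁿ` when `a · x = ∑ⱼ aⱼ xⱼ ≤ β`. [cite: LenstraHW1983, §1 (p. 538)] -/
def RowHolds {n : ℕ} (r : (Fin n → ℤ) × ℤ) (x : Fin n → ℤ) : Prop :=
  ∑ j, r.1 j * x j ≤ r.2

/-- `RowHolds` is decidable (integer arithmetic). [folklore] -/
instance decidableRowHolds {n : ℕ} (r : (Fin n → ℤ) × ℤ) (x : Fin n → ℤ) : Decidable (RowHolds r x) :=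
  inferInstanceAs (Decidable (_ ≤ _))

/-- FEASIBILITY, the ILP question of Lenstra 1983 §1: "decide whether there exists a vector `x ∈ ℤⁿ`
satisfying the system of `m` inequalities `Ax ≤ b`". [cite: LenstraHW1983, §1 (p. 538, problem statement)] -/
def Feasible (P : ILPInstance) : Prop :=
  ∃ x : Fin P.1 → ℤ, ∀ r ∈ P.2, RowHolds r x

/-- Unfolding of `Feasible`. [folklore] -/
theorem feasible_iff (P : ILPInstance) :
    P.Feasible ↔ ∃ x : Fin P.numVars → ℤ, ∀ r ∈ P.rows, ∑ j, r.1 j * x j ≤ r.2 :=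
  Iff.rfl

/-- `Feasible` in matrix form: for a `Fin m`-indexed system, `⟨n, [(A 0, b 0), …]⟩` is feasible iff
`∃ x, A *ᵥ x ≤ b`. [cite: LenstraHW1983, §1 (p. 538)] -/
theorem feasible_iff_mulVec {m n : ℕ} (A : Matrix (Fin m) (Fin n) ℤ) (b : Fin m → ℤ) :
    Feasible ⟨n, List.ofFn fun i => (A i, b i)⟩ ↔ ∃ x : Fin n → ℤ, A.mulVec x ≤ b := by
  simp only [Feasible, List.forall_mem_ofFn_iff, RowHolds, Pi.le_def, Matrix.mulVec, dotProduct]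

/-- The empty system is feasible. [folklore] -/
theorem feasible_nil (n : ℕ) : Feasible ⟨n, []⟩ :=
  ⟨0, fun _ h => (List.not_mem_nil h).elim⟩

/-- A system containing the row `0 · x ≤ β` with `β < 0` is infeasible. [folklore] -/
theorem not_feasible_of_mem {P : ILPInstance} {β : ℤ} (hβ : β < 0) (h : ((0 : Fin P.1 → ℤ), β) ∈ P.2) :
    ¬ P.Feasible := by
  rintro ⟨x, hx⟩
  have := hx _ h
  simp only [RowHolds, Pi.zero_apply, zero_mul, Finset.sum_const_zero] at this
  omega

/-! ### The real polyhedron of an instance -/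

/-- The polyhedron `{x ∈ ℝⁿ | Ax ≤ b}` of an instance (its real relaxation). [cite: Schrijver1986, §18.4 (the polyhedron `P = {x | Ax ≤ b}`)] -/
def polyhedron (P : ILPInstance) : Set (Fin P.1 → ℝ) :=
  {x | ∀ r ∈ P.2, ∑ j, (r.1 j : ℝ) * x j ≤ r.2}

/-- Membership in the polyhedron. [folklore] -/
theorem mem_polyhedron_iff (P : ILPInstance) (x : Fin P.1 → ℝ) :
    x ∈ P.polyhedron ↔ ∀ r ∈ P.2, ∑ j, (r.1 j : ℝ) * x j ≤ r.2 :=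
  Iff.rfl

/-- An integer vector satisfies a row iff its real image does. [folklore] -/
theorem rowHolds_iff_real {n : ℕ} (r : (Fin n → ℤ) × ℤ) (x : Fin n → ℤ) :
    RowHolds r x ↔ ∑ j, (r.1 j : ℝ) * (x j : ℝ) ≤ (r.2 : ℝ) := by
  rw [RowHolds, ← Int.cast_le (R := ℝ)]
  push_cast
  rfl

/-- Feasibility is the existence of an integer point in the polyhedron. [cite: LenstraHW1983, §1 (p. 538)] -/
theorem feasible_iff_exists_mem_polyhedron (P : ILPInstance) :
    P.Feasible ↔ ∃ x : Fin P.1 → ℤ, (fun j => (x j : ℝ)) ∈ P.polyhedron := by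
  simp only [Feasible, mem_polyhedron_iff, rowHolds_iff_real]

/-- BOUNDED instances: the real polyhedron `{x | Ax ≤ b}` is bounded (a polytope, possibly empty) —
the case to which Lenstra's recursion applies directly (Schrijver 1986, §18.4; the general case is
first reduced to it by bounds on small solutions, Cor. 17.1b). [cite: Schrijver1986, §18.4] -/
def IsBounded (P : ILPInstance) : Prop :=
  Bornology.IsBounded P.polyhedron

/-- An instance whose polyhedron is empty is bounded. [folklore] -/
theorem isBounded_of_polyhedron_eq_empty {P : ILPInstance} (h : P.polyhedron = ∅) : P.IsBounded := by
  rw [IsBounded, h]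
  exact Bornology.isBounded_empty

/-! ### The Boolean encoding and the languages -/

/-- The Boolean encoding of ILP instances: `⟨n, rows⟩ ↦ boolPair (encodeNat n) (listBool-code of the
rows)`, a row `(a, β)` coded by the pair of the `listBool` code of `(a₀, …, a_{n-1})` (sign–magnitude
integers) and the code of `β` — `Encoding.sigmaBool` / `.listBool` / `.pairBool` / `encodingFinVec` of
`BoolEncodings.lean`, `GraphEncodings.lean`. [cite: AroraBarak2009, §0.1] -/
def encoding : Encoding ILPInstance Bool :=
  Encoding.sigmaBool fun n => ((encodingFinVec encodingIntBool n).pairBool encodingIntBool).listBool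

open CodeFP in
/-- **The code of an ILP instance in the vocabulary of `CodeFP.lean`**: binary `n`, then the headed
list of the rows, each the pair (headed list of the sign–magnitude entries of `aᵢ`, sign–magnitude `bᵢ`).
[cite: AroraBarak2009, §0.1] -/
theorem encode_eq_pairE (n : ℕ) (rows : List ((Fin n → ℤ) × ℤ)) :
    encoding.encode ⟨n, rows⟩ =
      pairE natE (listE (pairE (listE smE) smE)) (n, rows.map fun r => (List.ofFn r.1, r.2)) := by
  change boolPair (encodeNat n)
      (((encodingFinVec encodingIntBool n).pairBool encodingIntBool).listBool.encode rows) = _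
  rw [listE_eq, pairE_apply]
  congr 1
  simp only [listE, List.length_map, rawE, List.map_map]
  congr 2
  refine List.map_congr_left fun r _ => ?_
  simp only [Function.comp_apply, pairE_apply]
  change boolPair (encodingIntBool.listBool.encode (List.ofFn r.1)) (encodingIntBool.encode r.2) = _
  rw [listE_eq]
  rfl

end ILPInstance

/-- The language ILP ⊆ {0,1}*: codes of feasible instances. [cite: LenstraHW1983, §1 (p. 538)] -/
def ilpLang : Language Bool :=
  ILPInstance.encoding.toLanguage {P | P.Feasible}

/-- ILP with a FIXED number `n` of variables: codes of feasible instances whose dimension field is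
`n` (the problem Lenstra 1983 solves in polynomial time for each fixed `n`). [cite: LenstraHW1983, §1 (p. 538)] -/
def ilpLangOfDim (n : ℕ) : Language Bool :=
  ILPInstance.encoding.toLanguage {P | P.1 = n ∧ P.Feasible}

/-- Membership of a code in `ilpLang` is feasibility. [folklore] -/
@[simp] theorem encode_mem_ilpLang_iff (P : ILPInstance) :
    ILPInstance.encoding.encode P ∈ ilpLang ↔ P.Feasible :=
  ILPInstance.encoding.mem_toLanguage_iff _ P

/-- Membership of a code in `ilpLangOfDim n`. [folklore] -/
@[simp] theorem encode_mem_ilpLangOfDim_iff (n : ℕ) (P : ILPInstance) :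
    ILPInstance.encoding.encode P ∈ ilpLangOfDim n ↔ P.numVars = n ∧ P.Feasible :=
  ILPInstance.encoding.mem_toLanguage_iff _ P

/-- The slices are contained in ILP. [folklore] -/
theorem ilpLangOfDim_le_ilpLang (n : ℕ) : ilpLangOfDim n ≤ ilpLang :=
  ILPInstance.encoding.toLanguage_mono fun _ h => h.2

/-- A string outside the range of the encoding lies in no slice. [folklore] -/
theorem mem_ilpLangOfDim_iff (n : ℕ) (w : List Bool) :
    w ∈ ilpLangOfDim n ↔ ∃ P : ILPInstance, P.numVars = n ∧ P.Feasible ∧ ILPInstance.encoding.encode P = w :=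
  ⟨fun ⟨P, hP, hw⟩ => ⟨P, hP.1, hP.2, hw⟩, fun ⟨P, h1, h2, hw⟩ => ⟨P, ⟨h1, h2⟩, hw⟩⟩

end Literature.Computability.Complexity
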